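import Mathlib.RingTheory.DiscreteValuationRing.Basic
import Mathlib.Tactic
import HarnessLib

/-!
# The norm form of `ℚ₂(ζ₁₆)⁺ = ℚ₂(θ)`, `θ⁴ − 4θ² + 2 = 0`, takes only the values `±1 (mod 16)` on units:
# `F(a,b,c,d) = 2^{4k}·ε` with `ε` a unit forces `ε ≡ ±1 (mod 16)` — dyadic residue arithmetic in any `2`-adically digitised domain

Topic `NumberTheory/NumberFields` (namespace `Literature.NumberTheory.NumberFields.QuarticNormForm`).  THEOREM-ONLY file (no definition, no named fact, no
instance, no `sorry`), written by the prover seat `bsd-line-att-p3` g46 (cell `bsd-f1-sign2`, route `AlignedTransportAtTwo`; `--supports`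
stmt-BirchSwinnertonDyer-22298, closes nothing).  LOCAL ALGEBRA brick of `DyadicUnitNotNormFromQuarticLayer.lean` (this seat): the unit hypothesis
«`ε ∉ N_{K_2/K} K_2ˣ`» of the PRO-CYCLIC DOOR (`IwasawaTheory/ClassGroupPRankLeOneOfNonNormUnitLayerTwo.lean`) in base-field congruence currency.

THE FORM (att-p3 g43, `IwasawaTheory/CyclotomicTwoLayerTwoNormForm.lean`): `N_{K(θ)/K}(a + bθ + cθ² + dθ³) = F(a,b,c,d)`,
  `F = a⁴ + 8a³c − 4a²b² − 24a²bd + 20a²c² − 40a²d² − 8ab²c − 32abcd + 16ac³ − 48acd² + 2b⁴ + 16b³d − 8b²c² + 40b²d² − 16bc²d + 32bd³ + 4c⁴ − 16c²d² + 8d⁴`.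

THE LEMMA (`exists_eq_of_normForm_eq_pow_mul`).  `S` a domain in which `2` is a non-unit, `2 ≠ 0`, and every element is `2s` or `1 + 2s` (e.g. the localisation of
the integers of a number field at a dyadic prime with `e = f = 1`; `ℤ₂`); `ε` a unit.  If `F(a,b,c,d) = 2^{4k}·ε` for some `a, b, c, d ∈ S` and `k ≥ 0`, then
**`ε = ±1 + 16q`** for some `q ∈ S`.  PROOF (valuations by hand): writing `2`-adic digits `a = a₀ + 4a₁`, `b = b₀ + 4b₁`, `c = c₀ + 2c₁`, `d = d₀ + 2d₁`,
`F ≡ F(a₀,b₀,c₀,d₀) (mod 16)` as a POLYNOMIAL identity (`normForm_shift`), and the `32` residues for `a₀ ∈ {1,3}` are `±1` (`normForm_base`); if `a` is even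
then `F = 2·odd`, `4·odd`, `8·odd` according as `b`, `c`, `d` is the first odd coordinate (`normForm_even_…`), and `F(2a,2b,2c,2d) = 16 F(a,b,c,d)`; so
`F = 2^{4k}ε` descends (`k ↦ k − 1`) until `k = 0`, where `a` must be odd.  This is the elementary content of «the norm group of `ℚ₂(ζ₁₆)⁺/ℚ₂` on units is
`±1 + 16ℤ₂`» (local class field theory: `N ℚ₂(ζ_{2ⁿ})ˣ = 2^ℤ × (1 + 2ⁿℤ₂)`), in the one direction the doors need.

HONEST SCOPE: elementary commutative algebra; nothing specific to any summit; BSD is not advanced by this file.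

References: [NeukirchANT1999] Ch. V §1 (norm groups of `ℚ_p(ζ_{pⁿ})`: `(p) × U^{(n)}`); [Omeara1963] §63A–B (dyadic unit residues and norms);
[Washington1997] §13.1 (`ℚ_2 = ℚ(ζ₁₆)⁺`, `K_2 = K·ℚ_2`).
-/

set_option autoImplicit false

namespace Literature.NumberTheory.NumberFields.QuarticNormForm

section Identities

variable {S : Type*} [CommRing S]

/-- Shifting `a` by a multiple of `4` changes `F` by a multiple of `16`. [folklore] -/
private theorem normForm_shift_a (a s b c d : S) :
    (a + 4 * s) ^ 4 + 8 * (a + 4 * s) ^ 3 * (c) - 4 * (a + 4 * s) ^ 2 * (b) ^ 2 - 24 * (a + 4 * s) ^ 2 * (b) * (d) + 20 * (a + 4 * s) ^ 2 * (c) ^ 2 - 40 * (a + 4 * s) ^ 2 * (d) ^ 2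
        - 8 * (a + 4 * s) * (b) ^ 2 * (c) - 32 * (a + 4 * s) * (b) * (c) * (d) + 16 * (a + 4 * s) * (c) ^ 3 - 48 * (a + 4 * s) * (c) * (d) ^ 2 + 2 * (b) ^ 4 + 16 * (b) ^ 3 * (d)
        - 8 * (b) ^ 2 * (c) ^ 2 + 40 * (b) ^ 2 * (d) ^ 2 - 16 * (b) * (c) ^ 2 * (d) + 32 * (b) * (d) ^ 3 + 4 * (c) ^ 4 - 16 * (c) ^ 2 * (d) ^ 2
        + 8 * (d) ^ 4 =
      (a ^ 4 + 8 * a ^ 3 * c - 4 * a ^ 2 * b ^ 2 - 24 * a ^ 2 * b * d + 20 * a ^ 2 * c ^ 2 - 40 * a ^ 2 * d ^ 2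
        - 8 * a * b ^ 2 * c - 32 * a * b * c * d + 16 * a * c ^ 3 - 48 * a * c * d ^ 2 + 2 * b ^ 4 + 16 * b ^ 3 * d
        - 8 * b ^ 2 * c ^ 2 + 40 * b ^ 2 * d ^ 2 - 16 * b * c ^ 2 * d + 32 * b * d ^ 3 + 4 * c ^ 4 - 16 * c ^ 2 * d ^ 2
        + 8 * d ^ 4) +
      16 * (a ^ 3 * s + 6 * a ^ 2 * c * s + 6 * a ^ 2 * s ^ 2 - 2 * a * b ^ 2 * s - 12 * a * b * d * s + 10 * a * c ^ 2 * s + 24 * a * c * s ^ 2 - 20 * a * d ^ 2 * s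
      + 16 * a * s ^ 3 - 2 * b ^ 2 * c * s - 4 * b ^ 2 * s ^ 2 - 8 * b * c * d * s - 24 * b * d * s ^ 2 + 4 * c ^ 3 * s + 20 * c ^ 2 * s ^ 2 - 12 * c * d ^ 2 * s
      + 32 * c * s ^ 3 - 40 * d ^ 2 * s ^ 2 + 16 * s ^ 4) := by
  ring

/-- Shifting `b` by a multiple of `4` changes `F` by a multiple of `16`. [folklore] -/
private theorem normForm_shift_b (a s b c d : S) :
    (a) ^ 4 + 8 * (a) ^ 3 * (c) - 4 * (a) ^ 2 * (b + 4 * s) ^ 2 - 24 * (a) ^ 2 * (b + 4 * s) * (d) + 20 * (a) ^ 2 * (c) ^ 2 - 40 * (a) ^ 2 * (d) ^ 2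
        - 8 * (a) * (b + 4 * s) ^ 2 * (c) - 32 * (a) * (b + 4 * s) * (c) * (d) + 16 * (a) * (c) ^ 3 - 48 * (a) * (c) * (d) ^ 2 + 2 * (b + 4 * s) ^ 4 + 16 * (b + 4 * s) ^ 3 * (d)
        - 8 * (b + 4 * s) ^ 2 * (c) ^ 2 + 40 * (b + 4 * s) ^ 2 * (d) ^ 2 - 16 * (b + 4 * s) * (c) ^ 2 * (d) + 32 * (b + 4 * s) * (d) ^ 3 + 4 * (c) ^ 4 - 16 * (c) ^ 2 * (d) ^ 2
        + 8 * (d) ^ 4 =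
      (a ^ 4 + 8 * a ^ 3 * c - 4 * a ^ 2 * b ^ 2 - 24 * a ^ 2 * b * d + 20 * a ^ 2 * c ^ 2 - 40 * a ^ 2 * d ^ 2
        - 8 * a * b ^ 2 * c - 32 * a * b * c * d + 16 * a * c ^ 3 - 48 * a * c * d ^ 2 + 2 * b ^ 4 + 16 * b ^ 3 * d
        - 8 * b ^ 2 * c ^ 2 + 40 * b ^ 2 * d ^ 2 - 16 * b * c ^ 2 * d + 32 * b * d ^ 3 + 4 * c ^ 4 - 16 * c ^ 2 * d ^ 2
        + 8 * d ^ 4) +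
      16 * (-2 * a ^ 2 * b * s - 6 * a ^ 2 * d * s - 4 * a ^ 2 * s ^ 2 - 4 * a * b * c * s - 8 * a * c * d * s - 8 * a * c * s ^ 2 + 2 * b ^ 3 * s + 12 * b ^ 2 * d * s
      + 12 * b ^ 2 * s ^ 2 - 4 * b * c ^ 2 * s + 20 * b * d ^ 2 * s + 48 * b * d * s ^ 2 + 32 * b * s ^ 3 - 4 * c ^ 2 * d * s - 8 * c ^ 2 * s ^ 2 + 8 * d ^ 3 * s
      + 40 * d ^ 2 * s ^ 2 + 64 * d * s ^ 3 + 32 * s ^ 4) := by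
  ring

/-- Shifting `c` by a multiple of `2` changes `F` by a multiple of `16`. [folklore] -/
private theorem normForm_shift_c (a s b c d : S) :
    (a) ^ 4 + 8 * (a) ^ 3 * (c + 2 * s) - 4 * (a) ^ 2 * (b) ^ 2 - 24 * (a) ^ 2 * (b) * (d) + 20 * (a) ^ 2 * (c + 2 * s) ^ 2 - 40 * (a) ^ 2 * (d) ^ 2
        - 8 * (a) * (b) ^ 2 * (c + 2 * s) - 32 * (a) * (b) * (c + 2 * s) * (d) + 16 * (a) * (c + 2 * s) ^ 3 - 48 * (a) * (c + 2 * s) * (d) ^ 2 + 2 * (b) ^ 4 + 16 * (b) ^ 3 * (d)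
        - 8 * (b) ^ 2 * (c + 2 * s) ^ 2 + 40 * (b) ^ 2 * (d) ^ 2 - 16 * (b) * (c + 2 * s) ^ 2 * (d) + 32 * (b) * (d) ^ 3 + 4 * (c + 2 * s) ^ 4 - 16 * (c + 2 * s) ^ 2 * (d) ^ 2
        + 8 * (d) ^ 4 =
      (a ^ 4 + 8 * a ^ 3 * c - 4 * a ^ 2 * b ^ 2 - 24 * a ^ 2 * b * d + 20 * a ^ 2 * c ^ 2 - 40 * a ^ 2 * d ^ 2
        - 8 * a * b ^ 2 * c - 32 * a * b * c * d + 16 * a * c ^ 3 - 48 * a * c * d ^ 2 + 2 * b ^ 4 + 16 * b ^ 3 * d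
        - 8 * b ^ 2 * c ^ 2 + 40 * b ^ 2 * d ^ 2 - 16 * b * c ^ 2 * d + 32 * b * d ^ 3 + 4 * c ^ 4 - 16 * c ^ 2 * d ^ 2
        + 8 * d ^ 4) +
      16 * (a ^ 3 * s + 5 * a ^ 2 * c * s + 5 * a ^ 2 * s ^ 2 - a * b ^ 2 * s - 4 * a * b * d * s + 6 * a * c ^ 2 * s + 12 * a * c * s ^ 2 - 6 * a * d ^ 2 * s + 8 * a * s ^ 3
      - 2 * b ^ 2 * c * s - 2 * b ^ 2 * s ^ 2 - 4 * b * c * d * s - 4 * b * d * s ^ 2 + 2 * c ^ 3 * s + 6 * c ^ 2 * s ^ 2 - 4 * c * d ^ 2 * s + 8 * c * s ^ 3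
      - 4 * d ^ 2 * s ^ 2 + 4 * s ^ 4) := by
  ring

/-- Shifting `d` by a multiple of `2` changes `F` by a multiple of `16`. [folklore] -/
private theorem normForm_shift_d (a s b c d : S) :
    (a) ^ 4 + 8 * (a) ^ 3 * (c) - 4 * (a) ^ 2 * (b) ^ 2 - 24 * (a) ^ 2 * (b) * (d + 2 * s) + 20 * (a) ^ 2 * (c) ^ 2 - 40 * (a) ^ 2 * (d + 2 * s) ^ 2
        - 8 * (a) * (b) ^ 2 * (c) - 32 * (a) * (b) * (c) * (d + 2 * s) + 16 * (a) * (c) ^ 3 - 48 * (a) * (c) * (d + 2 * s) ^ 2 + 2 * (b) ^ 4 + 16 * (b) ^ 3 * (d + 2 * s)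
        - 8 * (b) ^ 2 * (c) ^ 2 + 40 * (b) ^ 2 * (d + 2 * s) ^ 2 - 16 * (b) * (c) ^ 2 * (d + 2 * s) + 32 * (b) * (d + 2 * s) ^ 3 + 4 * (c) ^ 4 - 16 * (c) ^ 2 * (d + 2 * s) ^ 2
        + 8 * (d + 2 * s) ^ 4 =
      (a ^ 4 + 8 * a ^ 3 * c - 4 * a ^ 2 * b ^ 2 - 24 * a ^ 2 * b * d + 20 * a ^ 2 * c ^ 2 - 40 * a ^ 2 * d ^ 2
        - 8 * a * b ^ 2 * c - 32 * a * b * c * d + 16 * a * c ^ 3 - 48 * a * c * d ^ 2 + 2 * b ^ 4 + 16 * b ^ 3 * d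
        - 8 * b ^ 2 * c ^ 2 + 40 * b ^ 2 * d ^ 2 - 16 * b * c ^ 2 * d + 32 * b * d ^ 3 + 4 * c ^ 4 - 16 * c ^ 2 * d ^ 2
        + 8 * d ^ 4) +
      16 * (-3 * a ^ 2 * b * s - 10 * a ^ 2 * d * s - 10 * a ^ 2 * s ^ 2 - 4 * a * b * c * s - 12 * a * c * d * s - 12 * a * c * s ^ 2 + 2 * b ^ 3 * s + 10 * b ^ 2 * d * s
      + 10 * b ^ 2 * s ^ 2 - 2 * b * c ^ 2 * s + 12 * b * d ^ 2 * s + 24 * b * d * s ^ 2 + 16 * b * s ^ 3 - 4 * c ^ 2 * d * s - 4 * c ^ 2 * s ^ 2 + 4 * d ^ 3 * s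
      + 12 * d ^ 2 * s ^ 2 + 16 * d * s ^ 3 + 8 * s ^ 4) := by
  ring

/-- The `32` residues of `F(a₀, b₀, c₀, d₀)` modulo `16` for `a₀ ∈ {1, 3}`, `b₀ ∈ {0, 1, 2, 3}`, `c₀, d₀ ∈ {0, 1}`: all are `±1`
(`+1` exactly when `b₀` is even). [folklore] -/
private theorem normForm_base (a b c d : S) (ha : a = 1 ∨ a = 3) (hb : b = 0 ∨ b = 1 ∨ b = 2 ∨ b = 3)
    (hc : c = 0 ∨ c = 1) (hd : d = 0 ∨ d = 1) :
    ∃ k : S, a ^ 4 + 8 * a ^ 3 * c - 4 * a ^ 2 * b ^ 2 - 24 * a ^ 2 * b * d + 20 * a ^ 2 * c ^ 2 - 40 * a ^ 2 * d ^ 2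
        - 8 * a * b ^ 2 * c - 32 * a * b * c * d + 16 * a * c ^ 3 - 48 * a * c * d ^ 2 + 2 * b ^ 4 + 16 * b ^ 3 * d
        - 8 * b ^ 2 * c ^ 2 + 40 * b ^ 2 * d ^ 2 - 16 * b * c ^ 2 * d + 32 * b * d ^ 3 + 4 * c ^ 4 - 16 * c ^ 2 * d ^ 2
        + 8 * d ^ 4 = 1 + 16 * k ∨
      a ^ 4 + 8 * a ^ 3 * c - 4 * a ^ 2 * b ^ 2 - 24 * a ^ 2 * b * d + 20 * a ^ 2 * c ^ 2 - 40 * a ^ 2 * d ^ 2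
        - 8 * a * b ^ 2 * c - 32 * a * b * c * d + 16 * a * c ^ 3 - 48 * a * c * d ^ 2 + 2 * b ^ 4 + 16 * b ^ 3 * d
        - 8 * b ^ 2 * c ^ 2 + 40 * b ^ 2 * d ^ 2 - 16 * b * c ^ 2 * d + 32 * b * d ^ 3 + 4 * c ^ 4 - 16 * c ^ 2 * d ^ 2
        + 8 * d ^ 4 = -1 + 16 * k := by
  rcases ha with rfl | rfl <;> rcases hb with rfl | rfl | rfl | rfl <;> rcases hc with rfl | rfl <;> rcases hd with rfl | rfl
  · exact ⟨0, Or.inl (by norm_num)⟩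
  · exact ⟨-2, Or.inl (by norm_num)⟩
  · exact ⟨3, Or.inl (by norm_num)⟩
  · exact ⟨-3, Or.inl (by norm_num)⟩
  · exact ⟨0, Or.inr (by norm_num)⟩
  · exact ⟨2, Or.inr (by norm_num)⟩
  · exact ⟨2, Or.inr (by norm_num)⟩
  · exact ⟨-3, Or.inr (by norm_num)⟩
  · exact ⟨1, Or.inl (by norm_num)⟩
  · exact ⟨18, Or.inl (by norm_num)⟩
  · exact ⟨0, Or.inl (by norm_num)⟩
  · exact ⟨7, Or.inl (by norm_num)⟩
  · exact ⟨8, Or.inr (by norm_num)⟩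
  · exact ⟨57, Or.inr (by norm_num)⟩
  · exact ⟨2, Or.inr (by norm_num)⟩
  · exact ⟨38, Or.inr (by norm_num)⟩
  · exact ⟨5, Or.inl (by norm_num)⟩
  · exact ⟨-17, Or.inl (by norm_num)⟩
  · exact ⟨33, Or.inl (by norm_num)⟩
  · exact ⟨1, Or.inl (by norm_num)⟩
  · exact ⟨3, Or.inr (by norm_num)⟩
  · exact ⟨-27, Or.inr (by norm_num)⟩
  · exact ⟨29, Or.inr (by norm_num)⟩
  · exact ⟨-18, Or.inr (by norm_num)⟩
  · exact ⟨-2, Or.inl (by norm_num)⟩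
  · exact ⟨-29, Or.inl (by norm_num)⟩
  · exact ⟨18, Or.inl (by norm_num)⟩
  · exact ⟨-33, Or.inl (by norm_num)⟩
  · exact ⟨-5, Or.inr (by norm_num)⟩
  · exact ⟨-12, Or.inr (by norm_num)⟩
  · exact ⟨5, Or.inr (by norm_num)⟩
  · exact ⟨-33, Or.inr (by norm_num)⟩

/-- `F(2s, 1 + 2b, c, d) = 2·(odd)`. [folklore] -/
private theorem normForm_even_odd (s b c d : S) :
    (2 * s) ^ 4 + 8 * (2 * s) ^ 3 * (c) - 4 * (2 * s) ^ 2 * (1 + 2 * b) ^ 2 - 24 * (2 * s) ^ 2 * (1 + 2 * b) * (d) + 20 * (2 * s) ^ 2 * (c) ^ 2 - 40 * (2 * s) ^ 2 * (d) ^ 2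
        - 8 * (2 * s) * (1 + 2 * b) ^ 2 * (c) - 32 * (2 * s) * (1 + 2 * b) * (c) * (d) + 16 * (2 * s) * (c) ^ 3 - 48 * (2 * s) * (c) * (d) ^ 2 + 2 * (1 + 2 * b) ^ 4 + 16 * (1 + 2 * b) ^ 3 * (d)
        - 8 * (1 + 2 * b) ^ 2 * (c) ^ 2 + 40 * (1 + 2 * b) ^ 2 * (d) ^ 2 - 16 * (1 + 2 * b) * (c) ^ 2 * (d) + 32 * (1 + 2 * b) * (d) ^ 3 + 4 * (c) ^ 4 - 16 * (c) ^ 2 * (d) ^ 2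
        + 8 * (d) ^ 4 =
      2 * (1 + 2 * (8 * b ^ 4 + 32 * b ^ 3 * d + 16 * b ^ 3 - 8 * b ^ 2 * c ^ 2 - 16 * b ^ 2 * c * s + 40 * b ^ 2 * d ^ 2 + 48 * b ^ 2 * d - 16 * b ^ 2 * s ^ 2 + 12 * b ^ 2
      - 8 * b * c ^ 2 * d - 8 * b * c ^ 2 - 32 * b * c * d * s - 16 * b * c * s + 16 * b * d ^ 3 + 40 * b * d ^ 2 - 48 * b * d * s ^ 2 + 24 * b * d - 16 * b * s ^ 2
      + 4 * b + c ^ 4 + 8 * c ^ 3 * s - 4 * c ^ 2 * d ^ 2 - 4 * c ^ 2 * d + 20 * c ^ 2 * s ^ 2 - 2 * c ^ 2 - 24 * c * d ^ 2 * s - 16 * c * d * s + 16 * c * s ^ 3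
      - 4 * c * s + 2 * d ^ 4 + 8 * d ^ 3 - 40 * d ^ 2 * s ^ 2 + 10 * d ^ 2 - 24 * d * s ^ 2 + 4 * d + 4 * s ^ 4 - 4 * s ^ 2)) := by
  ring

/-- `F(2s, 2b, 1 + 2c, d) = 4·(odd)`. [folklore] -/
private theorem normForm_even_even_odd (s b c d : S) :
    (2 * s) ^ 4 + 8 * (2 * s) ^ 3 * (1 + 2 * c) - 4 * (2 * s) ^ 2 * (2 * b) ^ 2 - 24 * (2 * s) ^ 2 * (2 * b) * (d) + 20 * (2 * s) ^ 2 * (1 + 2 * c) ^ 2 - 40 * (2 * s) ^ 2 * (d) ^ 2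
        - 8 * (2 * s) * (2 * b) ^ 2 * (1 + 2 * c) - 32 * (2 * s) * (2 * b) * (1 + 2 * c) * (d) + 16 * (2 * s) * (1 + 2 * c) ^ 3 - 48 * (2 * s) * (1 + 2 * c) * (d) ^ 2 + 2 * (2 * b) ^ 4 + 16 * (2 * b) ^ 3 * (d)
        - 8 * (2 * b) ^ 2 * (1 + 2 * c) ^ 2 + 40 * (2 * b) ^ 2 * (d) ^ 2 - 16 * (2 * b) * (1 + 2 * c) ^ 2 * (d) + 32 * (2 * b) * (d) ^ 3 + 4 * (1 + 2 * c) ^ 4 - 16 * (1 + 2 * c) ^ 2 * (d) ^ 2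
        + 8 * (d) ^ 4 =
      4 * (1 + 2 * (4 * b ^ 4 + 16 * b ^ 3 * d - 16 * b ^ 2 * c ^ 2 - 16 * b ^ 2 * c * s - 16 * b ^ 2 * c + 20 * b ^ 2 * d ^ 2 - 8 * b ^ 2 * s ^ 2 - 8 * b ^ 2 * s - 4 * b ^ 2
      - 16 * b * c ^ 2 * d - 32 * b * c * d * s - 16 * b * c * d + 8 * b * d ^ 3 - 24 * b * d * s ^ 2 - 16 * b * d * s - 4 * b * d + 8 * c ^ 4 + 32 * c ^ 3 * s
      + 16 * c ^ 3 - 8 * c ^ 2 * d ^ 2 + 40 * c ^ 2 * s ^ 2 + 48 * c ^ 2 * s + 12 * c ^ 2 - 24 * c * d ^ 2 * s - 8 * c * d ^ 2 + 16 * c * s ^ 3 + 40 * c * s ^ 2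
      + 24 * c * s + 4 * c + d ^ 4 - 20 * d ^ 2 * s ^ 2 - 12 * d ^ 2 * s - 2 * d ^ 2 + 2 * s ^ 4 + 8 * s ^ 3 + 10 * s ^ 2 + 4 * s)) := by
  ring

/-- `F(2s, 2b, 2c, 1 + 2d) = 8·(odd)`. [folklore] -/
private theorem normForm_even_even_even_odd (s b c d : S) :
    (2 * s) ^ 4 + 8 * (2 * s) ^ 3 * (2 * c) - 4 * (2 * s) ^ 2 * (2 * b) ^ 2 - 24 * (2 * s) ^ 2 * (2 * b) * (1 + 2 * d) + 20 * (2 * s) ^ 2 * (2 * c) ^ 2 - 40 * (2 * s) ^ 2 * (1 + 2 * d) ^ 2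
        - 8 * (2 * s) * (2 * b) ^ 2 * (2 * c) - 32 * (2 * s) * (2 * b) * (2 * c) * (1 + 2 * d) + 16 * (2 * s) * (2 * c) ^ 3 - 48 * (2 * s) * (2 * c) * (1 + 2 * d) ^ 2 + 2 * (2 * b) ^ 4 + 16 * (2 * b) ^ 3 * (1 + 2 * d)
        - 8 * (2 * b) ^ 2 * (2 * c) ^ 2 + 40 * (2 * b) ^ 2 * (1 + 2 * d) ^ 2 - 16 * (2 * b) * (2 * c) ^ 2 * (1 + 2 * d) + 32 * (2 * b) * (1 + 2 * d) ^ 3 + 4 * (2 * c) ^ 4 - 16 * (2 * c) ^ 2 * (1 + 2 * d) ^ 2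
        + 8 * (1 + 2 * d) ^ 4 =
      8 * (1 + 2 * (2 * b ^ 4 + 16 * b ^ 3 * d + 8 * b ^ 3 - 8 * b ^ 2 * c ^ 2 - 8 * b ^ 2 * c * s + 40 * b ^ 2 * d ^ 2 + 40 * b ^ 2 * d - 4 * b ^ 2 * s ^ 2 + 10 * b ^ 2
      - 16 * b * c ^ 2 * d - 8 * b * c ^ 2 - 32 * b * c * d * s - 16 * b * c * s + 32 * b * d ^ 3 + 48 * b * d ^ 2 - 24 * b * d * s ^ 2 + 24 * b * d - 12 * b * s ^ 2
      + 4 * b + 4 * c ^ 4 + 16 * c ^ 3 * s - 16 * c ^ 2 * d ^ 2 - 16 * c ^ 2 * d + 20 * c ^ 2 * s ^ 2 - 4 * c ^ 2 - 48 * c * d ^ 2 * s - 48 * c * d * s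
      + 8 * c * s ^ 3 - 12 * c * s + 8 * d ^ 4 + 16 * d ^ 3 - 40 * d ^ 2 * s ^ 2 + 12 * d ^ 2 - 40 * d * s ^ 2 + 4 * d + s ^ 4 - 10 * s ^ 2)) := by
  ring

/-- `F` is homogeneous of degree `4`: `F(ua, ub, uc, ud) = u⁴ F(a, b, c, d)`. [folklore] -/
private theorem normForm_smul (u a b c d : S) :
    (u * a) ^ 4 + 8 * (u * a) ^ 3 * (u * c) - 4 * (u * a) ^ 2 * (u * b) ^ 2 - 24 * (u * a) ^ 2 * (u * b) * (u * d) + 20 * (u * a) ^ 2 * (u * c) ^ 2 - 40 * (u * a) ^ 2 * (u * d) ^ 2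
        - 8 * (u * a) * (u * b) ^ 2 * (u * c) - 32 * (u * a) * (u * b) * (u * c) * (u * d) + 16 * (u * a) * (u * c) ^ 3 - 48 * (u * a) * (u * c) * (u * d) ^ 2 + 2 * (u * b) ^ 4 + 16 * (u * b) ^ 3 * (u * d)
        - 8 * (u * b) ^ 2 * (u * c) ^ 2 + 40 * (u * b) ^ 2 * (u * d) ^ 2 - 16 * (u * b) * (u * c) ^ 2 * (u * d) + 32 * (u * b) * (u * d) ^ 3 + 4 * (u * c) ^ 4 - 16 * (u * c) ^ 2 * (u * d) ^ 2
        + 8 * (u * d) ^ 4 =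
      u ^ 4 * (a ^ 4 + 8 * a ^ 3 * c - 4 * a ^ 2 * b ^ 2 - 24 * a ^ 2 * b * d + 20 * a ^ 2 * c ^ 2 - 40 * a ^ 2 * d ^ 2
        - 8 * a * b ^ 2 * c - 32 * a * b * c * d + 16 * a * c ^ 3 - 48 * a * c * d ^ 2 + 2 * b ^ 4 + 16 * b ^ 3 * d
        - 8 * b ^ 2 * c ^ 2 + 40 * b ^ 2 * d ^ 2 - 16 * b * c ^ 2 * d + 32 * b * d ^ 3 + 4 * c ^ 4 - 16 * c ^ 2 * d ^ 2
        + 8 * d ^ 4) := by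
  ring

end Identities

/-! ## §2 `2`-adic digits and the residues of `F` -/

section Digits

variable {S : Type*} [CommRing S]

/-- Two `2`-adic digits: every element is `j + 4s` with `j ∈ {0,1,2,3}`. [folklore] -/
private theorem exists_eq_add_four_mul (hpar : ∀ r : S, ∃ s, r = 2 * s ∨ r = 1 + 2 * s) (r : S) :
    ∃ s : S, r = 4 * s ∨ r = 1 + 4 * s ∨ r = 2 + 4 * s ∨ r = 3 + 4 * s := by
  obtain ⟨s, hs⟩ := hpar r
  obtain ⟨s', hs'⟩ := hpar s
  refine ⟨s', ?_⟩
  rcases hs with rfl | rfl <;> rcases hs' with rfl | rfl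
  · exact Or.inl (by ring)
  · exact Or.inr (Or.inr (Or.inl (by ring)))
  · exact Or.inr (Or.inl (by ring))
  · exact Or.inr (Or.inr (Or.inr (by ring)))

/-- Bookkeeping: a base value `≡ ±1 (mod 16)` plus four multiples of `16` is `≡ ±1 (mod 16)`. [folklore] -/
private theorem exists_of_base_add {F0 : S} (Q1 Q2 Q3 Q4 : S) {k : S} (hk : F0 = 1 + 16 * k ∨ F0 = -1 + 16 * k) :
    ∃ q : S, F0 + 16 * Q4 + 16 * Q3 + 16 * Q2 + 16 * Q1 = 1 + 16 * q ∨
      F0 + 16 * Q4 + 16 * Q3 + 16 * Q2 + 16 * Q1 = -1 + 16 * q := by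
  rcases hk with rfl | rfl
  · exact ⟨k + Q4 + Q3 + Q2 + Q1, Or.inl (by ring)⟩
  · exact ⟨k + Q4 + Q3 + Q2 + Q1, Or.inr (by ring)⟩

/-- **`F(a,b,c,d) ≡ ±1 (mod 16)` when `a` is odd** (digits, the four shift identities and the `32` residues). [cite: Omeara1963, §63A (dyadic unit residues)] -/
theorem exists_normForm_eq_of_odd (hpar : ∀ r : S, ∃ s, r = 2 * s ∨ r = 1 + 2 * s) (a b c d : S) (ha : ∃ s, a = 1 + 2 * s) :
    ∃ q : S, a ^ 4 + 8 * a ^ 3 * c - 4 * a ^ 2 * b ^ 2 - 24 * a ^ 2 * b * d + 20 * a ^ 2 * c ^ 2 - 40 * a ^ 2 * d ^ 2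
        - 8 * a * b ^ 2 * c - 32 * a * b * c * d + 16 * a * c ^ 3 - 48 * a * c * d ^ 2 + 2 * b ^ 4 + 16 * b ^ 3 * d
        - 8 * b ^ 2 * c ^ 2 + 40 * b ^ 2 * d ^ 2 - 16 * b * c ^ 2 * d + 32 * b * d ^ 3 + 4 * c ^ 4 - 16 * c ^ 2 * d ^ 2
        + 8 * d ^ 4 = 1 + 16 * q ∨
      a ^ 4 + 8 * a ^ 3 * c - 4 * a ^ 2 * b ^ 2 - 24 * a ^ 2 * b * d + 20 * a ^ 2 * c ^ 2 - 40 * a ^ 2 * d ^ 2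
        - 8 * a * b ^ 2 * c - 32 * a * b * c * d + 16 * a * c ^ 3 - 48 * a * c * d ^ 2 + 2 * b ^ 4 + 16 * b ^ 3 * d
        - 8 * b ^ 2 * c ^ 2 + 40 * b ^ 2 * d ^ 2 - 16 * b * c ^ 2 * d + 32 * b * d ^ 3 + 4 * c ^ 4 - 16 * c ^ 2 * d ^ 2
        + 8 * d ^ 4 = -1 + 16 * q := by
  obtain ⟨s, rfl⟩ := ha
  obtain ⟨a1, ha1⟩ := hpar s
  obtain ⟨b1, hb1⟩ := exists_eq_add_four_mul hpar b
  obtain ⟨c1, hc1⟩ := hpar c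
  obtain ⟨d1, hd1⟩ := hpar d
  have ha' : ∃ a0 : S, (a0 = 1 ∨ a0 = 3) ∧ 1 + 2 * s = a0 + 4 * a1 := by
    rcases ha1 with rfl | rfl
    · exact ⟨1, Or.inl rfl, by ring⟩
    · exact ⟨3, Or.inr rfl, by ring⟩
  have hb' : ∃ b0 : S, (b0 = 0 ∨ b0 = 1 ∨ b0 = 2 ∨ b0 = 3) ∧ b = b0 + 4 * b1 := by
    rcases hb1 with h | h | h | h
    · exact ⟨0, Or.inl rfl, by rw [h]; ring⟩
    · exact ⟨1, Or.inr (Or.inl rfl), h⟩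
    · exact ⟨2, Or.inr (Or.inr (Or.inl rfl)), h⟩
    · exact ⟨3, Or.inr (Or.inr (Or.inr rfl)), h⟩
  have hc' : ∃ c0 : S, (c0 = 0 ∨ c0 = 1) ∧ c = c0 + 2 * c1 := by
    rcases hc1 with h | h
    · exact ⟨0, Or.inl rfl, by rw [h]; ring⟩
    · exact ⟨1, Or.inr rfl, h⟩
  have hd' : ∃ d0 : S, (d0 = 0 ∨ d0 = 1) ∧ d = d0 + 2 * d1 := by
    rcases hd1 with h | h
    · exact ⟨0, Or.inl rfl, by rw [h]; ring⟩
    · exact ⟨1, Or.inr rfl, h⟩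
  obtain ⟨a0, ha0, haeq⟩ := ha'
  obtain ⟨b0, hb0, rfl⟩ := hb'
  obtain ⟨c0, hc0, rfl⟩ := hc'
  obtain ⟨d0, hd0, rfl⟩ := hd'
  rw [haeq, normForm_shift_a, normForm_shift_b, normForm_shift_c, normForm_shift_d]
  obtain ⟨k, hk⟩ := normForm_base a0 b0 c0 d0 ha0 hb0 hc0 hd0
  exact exists_of_base_add _ _ _ _ hk

end Digits

/-! ## §3 The descent: `F(a,b,c,d) = 2^{4k}·ε` with `ε` a unit forces `ε ≡ ±1 (mod 16)` -/

section Descent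

variable {S : Type*} [CommRing S]

/-- `2⁴x = ε` ⟹ `ε = 2·(2³x)`. [folklore] -/
private theorem eq_two_mul_of_pow_four_mul_eq {x ε : S} (h : 2 ^ 4 * x = ε) : ε = 2 * (2 ^ 3 * x) := by
  rw [← h]; ring

/-- `4(1+2W) = ε` ⟹ `ε = 2·(2(1+2W))`. [folklore] -/
private theorem eq_two_mul_of_four_mul_eq {W ε : S} (h : 4 * (1 + 2 * W) = ε) : ε = 2 * (2 * (1 + 2 * W)) := by
  rw [← h]; ring

/-- `8(1+2W) = ε` ⟹ `ε = 2·(4(1+2W))`. [folklore] -/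
private theorem eq_two_mul_of_eight_mul_eq {W ε : S} (h : 8 * (1 + 2 * W) = ε) : ε = 2 * (4 * (1 + 2 * W)) := by
  rw [← h]; ring

variable [IsDomain S]

/-- `8(1+2W) = 2^{4(k+1)}ε` ⟹ `1 = 2·(2^{4k}ε − W)`. [folklore] -/
private theorem one_eq_two_mul_of_eight (h20 : (2 : S) ≠ 0) {W ε : S} {k : ℕ} (h : 8 * (1 + 2 * W) = 2 ^ (4 * (k + 1)) * ε) :
    (1 : S) = 2 * (2 ^ (4 * k) * ε - W) := by
  have h' : 1 + 2 * W = 2 * (2 ^ (4 * k) * ε) := by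
    refine mul_left_cancel₀ (pow_ne_zero 3 h20) ?_
    rw [show (2 : S) ^ 3 * (1 + 2 * W) = 8 * (1 + 2 * W) by ring, h]; ring
  linear_combination h'

/-- `4(1+2W) = 2^{4(k+1)}ε` ⟹ `1 = 2·(2·2^{4k}ε − W)`. [folklore] -/
private theorem one_eq_two_mul_of_four (h20 : (2 : S) ≠ 0) {W ε : S} {k : ℕ} (h : 4 * (1 + 2 * W) = 2 ^ (4 * (k + 1)) * ε) :
    (1 : S) = 2 * (2 * 2 ^ (4 * k) * ε - W) := by
  have h' : 1 + 2 * W = 2 * (2 * 2 ^ (4 * k) * ε) := by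
    refine mul_left_cancel₀ (pow_ne_zero 2 h20) ?_
    rw [show (2 : S) ^ 2 * (1 + 2 * W) = 4 * (1 + 2 * W) by ring, h]; ring
  linear_combination h'

/-- `2(1+2W) = 2^{4(k+1)}ε` ⟹ `1 = 2·(4·2^{4k}ε − W)`. [folklore] -/
private theorem one_eq_two_mul_of_two (h20 : (2 : S) ≠ 0) {W ε : S} {k : ℕ} (h : 2 * (1 + 2 * W) = 2 ^ (4 * (k + 1)) * ε) :
    (1 : S) = 2 * (4 * 2 ^ (4 * k) * ε - W) := by
  have h' : 1 + 2 * W = 2 * (4 * 2 ^ (4 * k) * ε) := by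
    refine mul_left_cancel₀ h20 ?_
    rw [h]; ring
  linear_combination h'

/-- ★★ **`F(a,b,c,d) = 2^{4k}ε`, `ε` a unit ⟹ `ε = ±1 + 16q`**, in a domain where `2 ≠ 0` is a non-unit and every element is `2s` or `1 + 2s` (a `2`-adically
digitised domain, e.g. `ℤ₂`, or `(𝓞_K)_𝔭` at a dyadic prime with `e = f = 1`).  By induction on `k`: if all four coordinates are even, `F/16 = F(a/2, …)`; otherwise
the first odd coordinate decides the exact power of `2` in `F` (`0`, `1`, `2`, `3` for `a`, `b`, `c`, `d`), incompatible with `2^{4k}·unit` unless `k = 0` and `a` is odd,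
where `F ≡ ±1 (mod 16)`.  («The norms of units from `ℚ₂(ζ₁₆)⁺` are `≡ ±1 (mod 16)`».) [cite: NeukirchANT1999, Ch. V §1 (norm group of `ℚ_p(ζ_{pⁿ})`)]
[cite: Omeara1963, §63B] -/
theorem exists_eq_of_normForm_eq_pow_mul (h2 : ¬ IsUnit (2 : S)) (h20 : (2 : S) ≠ 0)
    (hpar : ∀ r : S, ∃ s, r = 2 * s ∨ r = 1 + 2 * s) {ε : S} (hε : IsUnit ε) (k : ℕ) :
    ∀ a b c d : S, a ^ 4 + 8 * a ^ 3 * c - 4 * a ^ 2 * b ^ 2 - 24 * a ^ 2 * b * d + 20 * a ^ 2 * c ^ 2 - 40 * a ^ 2 * d ^ 2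
        - 8 * a * b ^ 2 * c - 32 * a * b * c * d + 16 * a * c ^ 3 - 48 * a * c * d ^ 2 + 2 * b ^ 4 + 16 * b ^ 3 * d
        - 8 * b ^ 2 * c ^ 2 + 40 * b ^ 2 * d ^ 2 - 16 * b * c ^ 2 * d + 32 * b * d ^ 3 + 4 * c ^ 4 - 16 * c ^ 2 * d ^ 2
        + 8 * d ^ 4 = 2 ^ (4 * k) * ε →
      ∃ q : S, ε = 1 + 16 * q ∨ ε = -1 + 16 * q := by
  -- `2 ∤ 1`, `2 ∤ ε`
  have hndvd1 : ∀ x : S, (1 : S) ≠ 2 * x := fun x hx => h2 (isUnit_of_dvd_one ⟨x, hx⟩)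
  have hndvdε : ∀ x : S, ε ≠ 2 * x := fun x hx => h2 (isUnit_of_dvd_unit ⟨x, hx⟩ hε)
  induction k with
  | zero =>
    intro a b c d h
    rw [Nat.mul_zero, pow_zero, one_mul] at h
    obtain ⟨sa, rfl | ha⟩ := hpar a
    · exfalso
      obtain ⟨sb, rfl | rfl⟩ := hpar b
      · obtain ⟨sc, rfl | rfl⟩ := hpar c
        · obtain ⟨sd, rfl | rfl⟩ := hpar d
          · rw [normForm_smul 2 sa sb sc sd] at h
            exact hndvdε _ (eq_two_mul_of_pow_four_mul_eq h)
          · rw [normForm_even_even_even_odd] at h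
            exact hndvdε _ (eq_two_mul_of_eight_mul_eq h)
        · rw [normForm_even_even_odd] at h
          exact hndvdε _ (eq_two_mul_of_four_mul_eq h)
      · rw [normForm_even_odd] at h
        exact hndvdε _ h.symm
    · obtain ⟨q, hq | hq⟩ := exists_normForm_eq_of_odd hpar a b c d ⟨sa, ha⟩
      · exact ⟨q, Or.inl (by rw [← h, hq])⟩
      · exact ⟨q, Or.inr (by rw [← h, hq])⟩
  | succ k ih =>
    intro a b c d h
    obtain ⟨sa, rfl | ha⟩ := hpar a
    · obtain ⟨sb, rfl | rfl⟩ := hpar b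
      · obtain ⟨sc, rfl | rfl⟩ := hpar c
        · obtain ⟨sd, rfl | rfl⟩ := hpar d
          · -- all even: descend
            refine ih sa sb sc sd (mul_left_cancel₀ (pow_ne_zero 4 h20) ?_)
            rw [← normForm_smul 2 sa sb sc sd, h]; ring
          · rw [normForm_even_even_even_odd] at h
            exact absurd (one_eq_two_mul_of_eight h20 h) (hndvd1 _)
        · rw [normForm_even_even_odd] at h
          exact absurd (one_eq_two_mul_of_four h20 h) (hndvd1 _)
      · rw [normForm_even_odd] at h
        exact absurd (one_eq_two_mul_of_two h20 h) (hndvd1 _)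
    · exfalso
      obtain ⟨q, hq | hq⟩ := exists_normForm_eq_of_odd hpar a b c d ⟨sa, ha⟩
      · exact hndvd1 (8 * 2 ^ (4 * k) * ε - 8 * q) (by linear_combination h - hq)
      · exact hndvd1 (8 * q - 8 * 2 ^ (4 * k) * ε) (by linear_combination hq - h)

end Descent

end Literature.NumberTheory.NumberFields.QuarticNormForm
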